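import Literature.AnabelianGeometry.EtaleTheta.SettingFreeProfiniteWitness
import Mathlib.Topology.Homeomorph.Lemmas
import HarnessLib

/-!
# [EtTh] §1 p. 12 "`Δ_X` is a profinite free group on 2 generators": TRANSPORT of the cell's freeness
# predicates along topological isomorphisms and closed embeddings (proof-only)

Mochizuki, *The étale theta function and its Frobenioid-theoretic manifestations*, Publ. RIMS **45**
(2009) [EtTh], §1, PRIMS PDF p. 12 (printed 238): "`Δ_X` is a profinite free group on 2 generators"
[cite: MochizukiEtTh2009, §1 p.12].  abc-iut cell, wave-5 prover seat abc-iut-w5-d218 (gen 2; gen 0 of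
the seat landed the non-vacuity witness `SettingFreeProfiniteWitness`).  PROOF-ONLY (no definition, no
named fact; Mathlib + the landed guard/witness files; nothing of another seat is edited or restated).

The printed hypothesis lives in the tree as `SemiGraphs.IsFreeProfiniteOn P x` (L3, a universal
property with uniqueness against finite discrete groups, for a family `x : ι → P`) and as the L2
vacuity guard `EtaleTheta.IsFreeProfiniteOnTwo P` (`= CompactSpace ∧ T2Space ∧ TotallyDisconnected ∧`
the same universal property for a pair); gen 0 proved both are satisfied by Mathlib's profinite
completion `F̂` of a free group.  A MODEL of the L2/L3 interfaces, however, carries `Δ_X` not as `F̂₂`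
itself but as a closed subgroup type `↥Δ` of some profinite `Π` that is merely ISOMORPHIC to `F̂₂`
(e.g. `F̂₂ × 1 ≤ F̂₂ × Ĝ`).  This file supplies the missing glue (RQ7 audit of p415416 by abc-iut-w5-d163,
INFO «holds UP TO TRANSPORT; the tree has no transport lemma», 2026-08-26T01:29:52Z):
* `SemiGraphs.IsFreeProfiniteOn.of_continuousMulEquiv` — `IsFreeProfiniteOn P x → IsFreeProfiniteOn P′ (e ∘ x)`
  for `e : P ≃ₜ* P′`; `SemiGraphs.IsFreeProfiniteOn.comp_equiv` — reindexing along `σ : ι′ ≃ ι`;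
* `EtaleTheta.IsFreeProfiniteOnTwo.of_continuousMulEquiv` — the guard is invariant under `≃ₜ*`;
  `EtaleTheta.isFreeProfiniteOnTwo_congr` — the `↔` form (first filed by abc-iut-w5-d163, p417805; the two
  seats' files for this path raced at the gate 02:32–02:34Z and p417846 was applied as a rewrite — the `↔`
  form is RESTORED here, universe-polymorphic, with the same name and binder);
* `EtaleTheta.IsFreeProfiniteOnTwo.range_of_injective` — for a continuous INJECTIVE homomorphism
  `f : P →ₜ* P′` into a Hausdorff group, `IsFreeProfiniteOnTwo P → IsFreeProfiniteOnTwo ↥f.range`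
  (a continuous bijection compact → Hausdorff is a homeomorphism, `Continuous.homeoOfEquivCompactToT2`);
* `EtaleTheta.isFreeProfiniteOnTwo_of_continuousMulEquiv_completion_freeGroup` /
  `EtaleTheta.isFreeProfiniteOnTwo_range_of_completion_freeGroup` — any profinite group topologically
  isomorphic to `F̂₂`, and the range of any continuous injective homomorphism `F̂₂ → Π` into a Hausdorff
  group, satisfies the guard (the shape a `ThetaSetting`/`OncePuncturedTemperedGroup` model needs).
HONEST FRAMING: classical profinite group theory (Ribes–Zalesskii, *Profinite Groups*, §3.3); nothing of
[EtTh] is asserted; no side is taken on any disputed claim.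
-/

noncomputable section

open Topology Function

universe u v

namespace Literature.AnabelianGeometry.SemiGraphs

variable {ι : Type*} {P P' : Type u} [Group P] [TopologicalSpace P] [Group P'] [TopologicalSpace P']

/-- **`IsFreeProfiniteOn` is invariant under topological isomorphisms**: if `P` is free profinite on
the family `x` (unique continuous extension of every map of the generators into a finite discrete
group) and `e : P ≃ₜ* P′`, then `P′` is free profinite on `e ∘ x` ([EtTh] p. 12 "a profinite free group
on 2 generators", transported; Ribes–Zalesskii §3.3). [cite: MochizukiEtTh2009, §1 p.12] -/
theorem IsFreeProfiniteOn.of_continuousMulEquiv {x : ι → P} (h : IsFreeProfiniteOn P x)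
    (e : P ≃ₜ* P') : IsFreeProfiniteOn P' (e ∘ x) := by
  intro F _ _ _ _ a
  obtain ⟨f, hf, huniq⟩ := h F a
  -- the candidate: `f ∘ e⁻¹`
  let es : P' →ₜ* P := ⟨e.symm.toMulEquiv.toMonoidHom, e.symm.continuous_toFun⟩
  have hes : ∀ y, es y = e.symm y := fun _ => rfl
  refine ⟨f.comp es, fun i => ?_, fun g hg => ?_⟩
  · change f (es (e (x i))) = a i
    rw [hes, e.symm_apply_apply, hf i]
  · -- uniqueness: `g ∘ e` and `f` agree on the generators, hence are equal; then cancel `e`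
    let ee : P →ₜ* P' := ⟨e.toMulEquiv.toMonoidHom, e.continuous_toFun⟩
    have hee : ∀ y, ee y = e y := fun _ => rfl
    have hcomp : g.comp ee = f := by
      refine huniq (g.comp ee) fun i => ?_
      change g (ee (x i)) = a i
      rw [hee, ← hg i]
      rfl
    refine ContinuousMonoidHom.ext fun y => ?_
    change g y = f (es y)
    rw [hes, ← hcomp]
    change g y = g (ee (e.symm y))
    rw [hee, e.apply_symm_apply]

/-- **`IsFreeProfiniteOn` is invariant under reindexing the generators**: for `σ : ι′ ≃ ι`,
`IsFreeProfiniteOn P x → IsFreeProfiniteOn P (x ∘ σ)` ([EtTh] p. 12, bookkeeping).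
[cite: MochizukiEtTh2009, §1 p.12] -/
theorem IsFreeProfiniteOn.comp_equiv {ι' : Type*} {x : ι → P} (h : IsFreeProfiniteOn P x)
    (σ : ι' ≃ ι) : IsFreeProfiniteOn P (x ∘ σ) := by
  intro F _ _ _ _ a
  obtain ⟨f, hf, huniq⟩ := h F (a ∘ σ.symm)
  refine ⟨f, fun i => ?_, fun g hg => huniq g fun j => ?_⟩
  · change f (x (σ i)) = a i
    rw [hf (σ i)]
    change a (σ.symm (σ i)) = a i
    rw [σ.symm_apply_apply]
  · have := hg (σ.symm j)
    change g (x (σ (σ.symm j))) = a (σ.symm j) at this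
    rwa [σ.apply_symm_apply] at this

end Literature.AnabelianGeometry.SemiGraphs

namespace Literature.AnabelianGeometry.EtaleTheta

open Literature.AnabelianGeometry.SemiGraphs

variable {P : Type u} {P' : Type v} [Group P] [TopologicalSpace P] [Group P'] [TopologicalSpace P']

/-- **The L2 guard `IsFreeProfiniteOnTwo` is invariant under topological isomorphisms**
(`e : P ≃ₜ* P′`): compactness, Hausdorffness and total disconnectedness pass along the homeomorphism,
and the unique-extension property for the pair `(a, b)` becomes that of `(e a, e b)` ([EtTh] p. 12
"`Δ_X` is a profinite free group on 2 generators"; the two sides may live in different universes, the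
test groups being in `Type`). [cite: MochizukiEtTh2009, §1 p.12] -/
theorem IsFreeProfiniteOnTwo.of_continuousMulEquiv (h : IsFreeProfiniteOnTwo P) (e : P ≃ₜ* P') :
    IsFreeProfiniteOnTwo P' := by
  obtain ⟨hc, ht, htd, a, b, hab⟩ := h
  refine ⟨e.toHomeomorph.compactSpace, e.toHomeomorph.t2Space, e.toHomeomorph.totallyDisconnectedSpace,
    e a, e b, fun Q _ _ _ _ u w => ?_⟩
  obtain ⟨f, ⟨hfa, hfb⟩, huniq⟩ := hab Q u w
  let es : P' →ₜ* P := ⟨e.symm.toMulEquiv.toMonoidHom, e.symm.continuous_toFun⟩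
  have hes : ∀ y, es y = e.symm y := fun _ => rfl
  refine ⟨f.comp es, ⟨?_, ?_⟩, fun g hg => ?_⟩
  · change f (es (e a)) = u
    rw [hes, e.symm_apply_apply, hfa]
  · change f (es (e b)) = w
    rw [hes, e.symm_apply_apply, hfb]
  · let ee : P →ₜ* P' := ⟨e.toMulEquiv.toMonoidHom, e.continuous_toFun⟩
    have hee : ∀ y, ee y = e y := fun _ => rfl
    have hcomp : g.comp ee = f := by
      refine huniq (g.comp ee) ⟨?_, ?_⟩
      · change g (ee a) = u
        rw [hee, hg.1]
      · change g (ee b) = w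
        rw [hee, hg.2]
    refine ContinuousMonoidHom.ext fun y => ?_
    change g y = f (es y)
    rw [hes, ← hcomp]
    change g y = g (ee (e.symm y))
    rw [hee, e.apply_symm_apply]

/-- **`IsFreeProfiniteOnTwo` is invariant under continuous multiplicative equivalences, `↔` form**
([EtTh] p. 12; first filed by abc-iut-w5-d163 as p417805 — restored verbatim in content, with the two
sides allowed in different universes). [cite: MochizukiEtTh2009, §1 p.12] -/
theorem isFreeProfiniteOnTwo_congr (e : P ≃ₜ* P') : IsFreeProfiniteOnTwo P ↔ IsFreeProfiniteOnTwo P' :=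
  ⟨fun h => h.of_continuousMulEquiv e, fun h => h.of_continuousMulEquiv e.symm⟩

/-- **The guard passes to the range of a continuous injective homomorphism into a Hausdorff group**:
if `P` satisfies `IsFreeProfiniteOnTwo` (in particular `P` is compact) and `f : P →ₜ* P′` is injective
with `P′` Hausdorff, then the closed subgroup type `↥f.range` satisfies `IsFreeProfiniteOnTwo` — the
continuous bijection `P → f.range` from a compact space to a Hausdorff space is a homeomorphism
(`Continuous.homeoOfEquivCompactToT2`).  This is the shape in which a model presents `Δ_X` (a closed
subgroup of `Π_X` isomorphic to `F̂₂`, [EtTh] p. 12). [cite: MochizukiEtTh2009, §1 p.12] -/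
theorem IsFreeProfiniteOnTwo.range_of_injective [T2Space P'] (h : IsFreeProfiniteOnTwo P)
    (f : P →ₜ* P') (hf : Injective f) : IsFreeProfiniteOnTwo f.toMonoidHom.range := by
  haveI : CompactSpace P := h.1
  -- the algebraic isomorphism onto the range, continuous into the subtype, hence a homeomorphism
  let m : P ≃* f.toMonoidHom.range := MonoidHom.ofInjective hf
  have hm : Continuous m := by
    refine Continuous.subtype_mk (map_continuous f) _
  let hh : P ≃ₜ f.toMonoidHom.range := Continuous.homeoOfEquivCompactToT2 (f := m.toEquiv) hm
  let e : P ≃ₜ* f.toMonoidHom.range :=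
    { m with
      continuous_toFun := hh.continuous_toFun
      continuous_invFun := hh.continuous_invFun }
  exact h.of_continuousMulEquiv e

/-- **Any profinite group topologically isomorphic to `F̂₂` satisfies the guard**: for
`e : F̂₂ ≃ₜ* P` with `F̂₂` Mathlib's profinite completion of the free group on `Fin 2`,
`IsFreeProfiniteOnTwo P` ([EtTh] p. 12; gen 0's witness
`isFreeProfiniteOnTwo_profiniteCompletion_freeGroup`, transported). [cite: MochizukiEtTh2009, §1 p.12] -/
theorem isFreeProfiniteOnTwo_of_continuousMulEquiv_completion_freeGroup
    (e : ProfiniteGrp.ProfiniteCompletion.completion (GrpCat.of (FreeGroup (Fin 2))) ≃ₜ* P') :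
    IsFreeProfiniteOnTwo P' :=
  isFreeProfiniteOnTwo_profiniteCompletion_freeGroup.of_continuousMulEquiv e

/-- **The range of any continuous injective homomorphism `F̂₂ → Π` into a Hausdorff topological group
satisfies the guard** `IsFreeProfiniteOnTwo` — e.g. `Δ_X := F̂₂ × 1 ≤ F̂₂ × Ĝ =: Π_X` in a product model
of the [EtTh] §1 interfaces ([EtTh] p. 12). [cite: MochizukiEtTh2009, §1 p.12] -/
theorem isFreeProfiniteOnTwo_range_of_completion_freeGroup [T2Space P']
    (f : ProfiniteGrp.ProfiniteCompletion.completion (GrpCat.of (FreeGroup (Fin 2))) →ₜ* P')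
    (hf : Injective f) : IsFreeProfiniteOnTwo f.toMonoidHom.range :=
  isFreeProfiniteOnTwo_profiniteCompletion_freeGroup.range_of_injective f hf

/-- **`IsFreeProfiniteOn` for a `Fin 2`-family passes to the range of a continuous injective
homomorphism into a Hausdorff group** (the L3 formulation of the same transport, via
`isFreeProfiniteOnTwo_iff`): there is a `Fin 2`-family in `↥f.range` on which it is free profinite.
[cite: MochizukiEtTh2009, §1 p.12] -/
theorem exists_isFreeProfiniteOn_range_of_injective {Q Q' : Type} [Group Q] [TopologicalSpace Q]
    [CompactSpace Q] [T2Space Q] [TotallyDisconnectedSpace Q] [Group Q'] [TopologicalSpace Q']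
    [IsTopologicalGroup Q'] [T2Space Q'] {x : Fin 2 → Q} (h : IsFreeProfiniteOn Q x) (f : Q →ₜ* Q')
    (hf : Injective f) : ∃ y : Fin 2 → f.toMonoidHom.range, IsFreeProfiniteOn (↥f.toMonoidHom.range) y := by
  have h2 : IsFreeProfiniteOnTwo Q :=
    (isFreeProfiniteOnTwo_iff Q).mpr ⟨inferInstance, inferInstance, inferInstance, x, h⟩
  exact ((isFreeProfiniteOnTwo_iff _).mp (h2.range_of_injective f hf)).2.2.2

end Literature.AnabelianGeometry.EtaleTheta

end
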